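import Mathlib.Algebra.Polynomial.Derivative
import Mathlib.Algebra.Polynomial.Div
import Mathlib.Algebra.Ring.GeomSum
import Mathlib.Algebra.MvPolynomial.Funext
import Mathlib.Algebra.MvPolynomial.Equiv
import Literature.Computability.AlgebraicComplexity.DDS21TopFaninTwoNormalForm
import Literature.RingTheory.MvPolynomial.DegreeOfTruncation
import Literature.AlgebraicGeometry.Hironaka2017.RationalApex
import HarnessLib

/-!
# DDS 2021, Thm. 3.2 for top fan-in `k = 2`, Part (B): the DiDIL step on the `ε`-side

Theorem-only file (cell `val-lit`, row X2-DDS21, «t19 lineage», the `k = 2` case of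
`DDS2021_thm_3_2`, `ε`-side; 0 definitions, 0 named facts). Sources: P. Dutta, P. Dwivedi,
N. Saxena, *Demystifying the border of depth-3 algebraic circuits*, FOCS 2021 / full version
[DuttaDwivediSaxena2022] (held text `paper:galaxy-pdf-7641649743695546420`, §3.1 proof of Thm. 3.2,
p0028 L745 – p0029 L773 and p0031 L836 – p0032 L858: the map `Φ : x_i ↦ z · x_i + α_i`, "DiDIL" =
divide by one product, differentiate in `z`; the logarithmic derivative distributes over products,
and Eqn. (3.3) `dlog(A − zB) = −(B/A) ∑_j (zB/A)^j`, truncated mod `z^N`, lands in `Σ∧Σ`), and the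
survey
P. Dutta, V. Lysikov, *Border complexity in algebraic complexity theory* [DuttaLysikov2025]
(arXiv:2510.13049, §4.4.1 "The `k = 2` case", p0023 L40 – p0024 L30), whose two-summand proof is
the one followed here: for `T₁ + T₂ = f + ε S` in the balanced normal form of Part (A)
(`DDS21TopFaninTwoNormalForm.lean`: `∑_i C(s_i) ∏_j ℓ̂_{ij} = ε^a · H`, `H|_{ε=0} = κ f`), after `Φ`
every `ℓ̂_{ij}` becomes `A_{ij} + z · B_{ij}` with `A_{ij}(0) ≠ 0`, and the Wronskian
`W₀' W₁ − W₀ W₁'` of the two products `W_i := Φ(T_i)` is, modulo `z^N` and up to the unit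
`∏ A_{ij}^N`, the product `W₀ W₁ · Ẽ` with `Ẽ` an explicit sum of `2d` powers of the linear forms
`B_{ij}` (the truncated geometric series of `dlog`). Since `W₀ + W₁ = ε^a Φ(H)`, the Wronskian equals
`ε^a (Φ(H)' W₁ − Φ(H) W₁')`; dividing the `ε`-power out coefficientwise (the `z`-constant term of
`W₀ W₁` is a unit of `F[ε]`, so `W₀ W₁` is inverted mod `z^N` by a geometric series) and setting
`ε = 0` gives the identity of `theorem border_spsClass_two_dlog_identity`:

  `c · (g' w₁ − g w₁') ≡ w₀ w₁ · ∑_{r<N} q_r z^r  (mod z^N)`, `g = Φ(f)`, `w_i = Φ(T_i)|_{ε=0}`,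
  `c ∈ F ∖ {0}`, `q_r ∈ border Σ∧Σ(2d, r+1)`, `w₁(z = 0) ∈ F ∖ {0}`, `g(z = 0) = f(α)`,

in the frame `Polynomial (MvPolynomial (Fin n) F)` (`z = Polynomial.X`), together with the bridge
`finSuccEquiv F n (aeval (x_i ↦ x_0 x_{i+1} + α_i) f) = Φ(f)` to the `MvPolynomial (Fin (n+1)) F`
frame of `UABPToolkit.lean` / `DDS21TraceBackFinalStep.lean`.

§4–§5 (v2) then SOLVE the congruence (DDS Claim 3.7 "trace back", for `k = 2`, without
denominators: `X_pow_succ_dvd_of_wronskian`, `dlog_identity_solve` over any domain `S` of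
characteristic `0`) and transport it (`truncDegreeOf_zero_eq_iff`) to that frame:
`theorem border_spsClass_two_traceback` gives
`λ^N c · Φ(f) ≡ Φ(T_1) · (c λ^{N−1} f(α) + ∫_N [Φ(T_0) · (∑_{r<N} z^r q_r) · U]) (mod z^{N+1})`,
`λ = T_1(α)`, `U = ∑_{k<N} λ^k (λ − Φ(T_1))^{N−1−k}`, `∫_N = integrateDegreeOf 0 N` — the hypothesis
shape of `uabpComputes_of_phi_truncDegreeOf_eq` (the ABP budgets — B3/B5 — are the consumers');
and (v3) `theorem border_spsClass_two_wronskian_congr` restates the §3 congruence itself in that frame,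
`∂_0 Φ(f) · Φ(T_1) − Φ(f) · ∂_0 Φ(T_1) ≡ c⁻¹ Φ(T_0) Φ(T_1) ∑_{r<N} x_0^r q_r (mod x_0^N)` as an equality
of `truncDegreeOf 0 N` — the hypothesis `hP` of the ABP-side trace-back `uabpComputes_of_wronskian_congr`.

Honest framing: this is the `ε`-side algebra of the `k = 2` case only; `DDS2021_thm_3_2` (all `k`)
remains OPEN by name; `VP ≠ VNP` is NOT proved and nothing here bears on it.
-/

open MvPolynomial Finset
open scoped Polynomial

namespace Literature.Computability.AlgebraicComplexity

namespace DDS2021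

/-! ## §1 Generic `z`-adic algebra in `S[z]` (`S` a commutative ring) -/

section Generic

variable {S : Type*} [CommRing S]

/-- Coefficients below `N` agree when `z^N` divides the difference. [folklore] -/
private theorem coeff_eq_of_X_pow_dvd_sub {N : ℕ} {p q : Polynomial S}
    (h : Polynomial.X ^ N ∣ p - q) {r : ℕ} (hr : r < N) : p.coeff r = q.coeff r := by
  have h' := (Polynomial.X_pow_dvd_iff.mp h) r hr
  rwa [Polynomial.coeff_sub, sub_eq_zero] at h'

/-- Conversely, `z^N` divides the difference when the coefficients below `N` agree. [folklore] -/
private theorem X_pow_dvd_sub_of_coeff_eq {N : ℕ} {p q : Polynomial S}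
    (h : ∀ r < N, p.coeff r = q.coeff r) : Polynomial.X ^ N ∣ p - q :=
  Polynomial.X_pow_dvd_iff.mpr fun r hr => by rw [Polynomial.coeff_sub, h r hr, sub_self]

/-- `z^N ∣ p^N` when `p(0) = 0`. [folklore] -/
private theorem X_pow_dvd_pow_of_coeff_zero {p : Polynomial S} (hp : p.coeff 0 = 0) (N : ℕ) :
    Polynomial.X ^ N ∣ p ^ N :=
  pow_dvd_pow_of_dvd (Polynomial.X_dvd_iff.mpr hp) N

/-- `(A + zB)' = B`. [folklore] -/
private theorem derivative_C_add_X_mul_C (a b : S) :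
    Polynomial.derivative (Polynomial.C a + Polynomial.X * Polynomial.C b) = Polynomial.C b := by
  rw [Polynomial.derivative_add, Polynomial.derivative_C, zero_add, Polynomial.derivative_mul,
    Polynomial.derivative_X, one_mul, Polynomial.derivative_C, mul_zero, add_zero]

/-- The `z`-constant term of `σ · ∏_j (A_j + z B_j)` is `σ ∏_j A_j`. [folklore] -/
private theorem coeff_zero_C_mul_prod_affine {ι : Type*} (t : Finset ι) (σ : S) (A B : ι → S) :
    (Polynomial.C σ * ∏ j ∈ t, (Polynomial.C (A j) + Polynomial.X * Polynomial.C (B j))).coeff 0 =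
      σ * ∏ j ∈ t, A j := by
  rw [Polynomial.coeff_zero_eq_eval_zero, Polynomial.eval_mul, Polynomial.eval_C,
    Polynomial.eval_prod]
  refine congrArg _ (Finset.prod_congr rfl fun j _ => ?_)
  rw [Polynomial.eval_add, Polynomial.eval_C, Polynomial.eval_mul, Polynomial.eval_X, zero_mul,
    add_zero]

/-- **Truncated inverse of a `z`-affine form** (DDS Eqn. (3.3): "`dlog(ℓ) = −(B/A) · ∑_j (zB/A)^j`"
for `ℓ = A − zB`; here without denominators): `E_N(A,B) · (A + zB) = A^N − (−zB)^N` for the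
geometric sum `E_N(A,B) := ∑_{k<N} A^k (−zB)^{N−1−k}`. [cite: DuttaDwivediSaxena2022, §3.1 proof of
Claim 3.6, Eqn. (3.3) (full version p0032 L851–858)] -/
theorem geomInv_mul_affine (a b : S) (N : ℕ) :
    (∑ k ∈ range N, Polynomial.C a ^ k * (-(Polynomial.X * Polynomial.C b)) ^ (N - 1 - k)) *
        (Polynomial.C a + Polynomial.X * Polynomial.C b) =
      Polynomial.C a ^ N - (-(Polynomial.X * Polynomial.C b)) ^ N := by
  rw [← sub_neg_eq_add (Polynomial.C a)]
  exact geom_sum₂_mul _ _ N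

/-- The `z^r`-coefficient of `E_N(A,B)` (`r < N`) is `A^{N−1−r} (−B)^r`. [folklore] -/
private theorem coeff_geomInv (a b : S) {N r : ℕ} (hr : r < N) :
    (∑ k ∈ range N, Polynomial.C a ^ k * (-(Polynomial.X * Polynomial.C b)) ^ (N - 1 - k)).coeff r =
      a ^ (N - 1 - r) * (-b) ^ r := by
  have hterm : ∀ k, Polynomial.C a ^ k * (-(Polynomial.X * Polynomial.C b)) ^ (N - 1 - k) =
      Polynomial.C (a ^ k * (-b) ^ (N - 1 - k)) * Polynomial.X ^ (N - 1 - k) := by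
    intro k
    rw [show -(Polynomial.X * Polynomial.C b) = Polynomial.C (-b) * Polynomial.X by
      rw [map_neg]; ring, mul_pow, map_mul, map_pow, map_pow]
    ring
  simp_rw [hterm]
  rw [Polynomial.finsetSum_coeff, Finset.sum_eq_single (N - 1 - r)]
  · rw [Polynomial.coeff_C_mul_X_pow, if_pos (by omega), show N - 1 - (N - 1 - r) = r by omega]
  · intro k hk hkr
    rw [Polynomial.coeff_C_mul_X_pow, if_neg]
    rw [Finset.mem_range] at hk
    omega
  · intro h
    exact absurd (Finset.mem_range.mpr (by omega)) h

/-- **The `k = 2` Wronskian/`dlog` identity mod `z^N`** (the algebraic core of DiDIL for two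
summands: "dlog distributes the product additively" and Eqn. (3.3), DDS full version p0031 L836 –
p0032 L858, combined as in [DuttaLysikov2025] §4.4.1 (arXiv:2510.13049 p0023 L40 – p0024 L30)):
for `W_i := σ_i ∏_j (A_{ij} + z B_{ij})` (`i = 0, 1`),
`Λ := ∏_{ij} A_{ij}`, `Λ'_{ij} := (∏_{(i',j') ≠ (i,j)} A_{i'j'})^N` and
`Ẽ := ∑_j Λ'_{0j} B_{0j} E_N(A_{0j},B_{0j}) − ∑_j Λ'_{1j} B_{1j} E_N(A_{1j},B_{1j})`,
`z^N` divides `W₀ W₁ · Ẽ − Λ^N · (W₀' W₁ − W₀ W₁')`.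
[cite: DuttaDwivediSaxena2022, §3.1 proof of Claim 3.6, Eqn. (3.3) (full version p0031 L836 –
p0032 L858)] -/
theorem wronskian_dlog_congr {d : ℕ} (N : ℕ) (σ : Fin 2 → S) (A B : Fin 2 → Fin d → S)
    (W : Fin 2 → Polynomial S)
    (hW : ∀ i, W i = Polynomial.C (σ i) * ∏ j, (Polynomial.C (A i j) + Polynomial.X * Polynomial.C (B i j))) :
    Polynomial.X ^ N ∣
      W 0 * W 1 *
        ((∑ j, Polynomial.C ((∏ p ∈ univ.erase ((0 : Fin 2), j), A p.1 p.2) ^ N * B 0 j) *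
            (∑ k ∈ range N, Polynomial.C (A 0 j) ^ k *
              (-(Polynomial.X * Polynomial.C (B 0 j))) ^ (N - 1 - k))) -
          ∑ j, Polynomial.C ((∏ p ∈ univ.erase ((1 : Fin 2), j), A p.1 p.2) ^ N * B 1 j) *
            (∑ k ∈ range N, Polynomial.C (A 1 j) ^ k *
              (-(Polynomial.X * Polynomial.C (B 1 j))) ^ (N - 1 - k))) -
      Polynomial.C ((∏ p : Fin 2 × Fin d, A p.1 p.2) ^ N) *
        (Polynomial.derivative (W 0) * W 1 - W 0 * Polynomial.derivative (W 1)) := by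
  classical
  -- names
  set L : Fin 2 → Fin d → Polynomial S := fun i j =>
    Polynomial.C (A i j) + Polynomial.X * Polynomial.C (B i j) with hL
  have hW' : ∀ i, W i = Polynomial.C (σ i) * ∏ j, L i j := hW
  set E : Fin 2 → Fin d → Polynomial S := fun i j =>
    ∑ k ∈ range N, Polynomial.C (A i j) ^ k * (-(Polynomial.X * Polynomial.C (B i j))) ^ (N - 1 - k)
    with hE
  set Λ : S := ∏ p : Fin 2 × Fin d, A p.1 p.2 with hΛ
  set Λ' : Fin 2 → Fin d → S := fun i j => (∏ p ∈ univ.erase (i, j), A p.1 p.2) ^ N with hΛ'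
  set P' : Fin 2 → Fin d → Polynomial S := fun i j => ∏ j' ∈ univ.erase j, L i j' with hP'
  set J : Fin 2 → Fin d → Polynomial S := fun i j =>
    Polynomial.C (σ i) * P' i j * (Polynomial.C (Λ' i j) * Polynomial.C (B i j)) *
      ((-1) ^ N * Polynomial.C (B i j) ^ N) with hJ
  -- basic identities
  have hEL : ∀ i j, E i j * L i j =
      Polynomial.C (A i j) ^ N - (-(Polynomial.X * Polynomial.C (B i j))) ^ N :=
    fun i j => geomInv_mul_affine (A i j) (B i j) N
  have hWsplit : ∀ i j, W i = Polynomial.C (σ i) * (L i j * P' i j) := by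
    intro i j
    rw [hW' i, hP', ← Finset.mul_prod_erase _ _ (Finset.mem_univ j)]
  have hΛN : ∀ i j, Polynomial.C (Λ ^ N) = Polynomial.C (A i j) ^ N * Polynomial.C (Λ' i j) := by
    intro i j
    simp only [hΛ, hΛ']
    rw [← Finset.mul_prod_erase _ _ (Finset.mem_univ (i, j)), mul_pow, map_mul, map_pow]
  have hy : ∀ i j, (-(Polynomial.X * Polynomial.C (B i j))) ^ N =
      Polynomial.X ^ N * ((-1) ^ N * Polynomial.C (B i j) ^ N) := by
    intro i j
    rw [neg_pow, mul_pow]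
    ring
  -- per-term identity
  have hterm : ∀ i j, W i * (Polynomial.C (Λ' i j * B i j) * E i j) =
      Polynomial.C (Λ ^ N) * (Polynomial.C (σ i) * (P' i j * Polynomial.C (B i j))) -
        Polynomial.X ^ N * J i j := by
    intro i j
    have h1 : W i * (Polynomial.C (Λ' i j * B i j) * E i j) =
        Polynomial.C (σ i) * P' i j * Polynomial.C (Λ' i j * B i j) * (E i j * L i j) := by
      rw [hWsplit i j]; ring
    rw [h1, hEL i j, hy i j, map_mul, hΛN i j]
    simp only [hJ]
    ring
  -- derivatives of the products
  have hWd : ∀ i, Polynomial.derivative (W i) =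
      Polynomial.C (σ i) * ∑ j, P' i j * Polynomial.C (B i j) := by
    intro i
    rw [hW' i, Polynomial.derivative_C_mul, Polynomial.derivative_prod_finset]
    refine congrArg _ (Finset.sum_congr rfl fun j _ => ?_)
    rw [hP', hL, derivative_C_add_X_mul_C]
  -- sum of the per-term identities
  have hsum : ∀ i, W i * ∑ j, Polynomial.C (Λ' i j * B i j) * E i j =
      Polynomial.C (Λ ^ N) * Polynomial.derivative (W i) - Polynomial.X ^ N * ∑ j, J i j := by
    intro i
    rw [Finset.mul_sum, Finset.sum_congr rfl fun j _ => hterm i j, Finset.sum_sub_distrib,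
      ← Finset.mul_sum, ← Finset.mul_sum, ← Finset.mul_sum, hWd i]
  -- assemble
  have key : W 0 * W 1 * (∑ j, Polynomial.C (Λ' 0 j * B 0 j) * E 0 j -
      ∑ j, Polynomial.C (Λ' 1 j * B 1 j) * E 1 j) -
      Polynomial.C (Λ ^ N) * (Polynomial.derivative (W 0) * W 1 - W 0 * Polynomial.derivative (W 1)) =
      Polynomial.X ^ N * -(W 1 * ∑ j, J 0 j - W 0 * ∑ j, J 1 j) := by
    rw [mul_sub (W 0 * W 1), show W 0 * W 1 * ∑ j, Polynomial.C (Λ' 0 j * B 0 j) * E 0 j =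
        W 1 * (W 0 * ∑ j, Polynomial.C (Λ' 0 j * B 0 j) * E 0 j) by ring,
      show W 0 * W 1 * ∑ j, Polynomial.C (Λ' 1 j * B 1 j) * E 1 j =
        W 0 * (W 1 * ∑ j, Polynomial.C (Λ' 1 j * B 1 j) * E 1 j) by ring, hsum 0, hsum 1]
    ring
  exact ⟨_, key⟩

/-- **Dividing out the `ε`-power coefficientwise** (DDS "[Divide]" step, p0028 L758 – p0029 L765:
`Φ(T) = ε^a · T̃` with `T̃|_{z=0}` a unit; here for `k = 2` and without denominators): if
`z^N ∣ Π Ẽ − μ · Wr`, `Wr = τ · M₁` and `Π(0) = λ`, then with the truncated inverse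
`Π̃ := ∑_{k<N} λ^k (λ − Π)^{N−1−k}` of `Π` one has `z^N ∣ λ^N Ẽ − τ · (μ Π̃ M₁)`.
[cite: DuttaDwivediSaxena2022, §3.1 proof of Thm. 3.2, "Divide and derive" (full version p0028 L758 –
p0029 L767)] -/
theorem X_pow_dvd_unit_mul_sub {N : ℕ} {Pp Et Wr M₁ : Polynomial S} {μ τ lam : S}
    (h1 : Polynomial.X ^ N ∣ Pp * Et - Polynomial.C μ * Wr) (h2 : Wr = Polynomial.C τ * M₁)
    (h3 : Pp.coeff 0 = lam) :
    Polynomial.X ^ N ∣ Polynomial.C (lam ^ N) * Et -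
      Polynomial.C τ * (Polynomial.C μ *
        (∑ k ∈ range N, Polynomial.C lam ^ k * (Polynomial.C lam - Pp) ^ (N - 1 - k)) * M₁) := by
  set Pt := ∑ k ∈ range N, Polynomial.C lam ^ k * (Polynomial.C lam - Pp) ^ (N - 1 - k) with hPt
  have hgeom : Pt * Pp = Polynomial.C lam ^ N - (Polynomial.C lam - Pp) ^ N := by
    have h := geom_sum₂_mul (Polynomial.C lam) (Polynomial.C lam - Pp) N
    rwa [sub_sub_cancel] at h
  have hdiv : Polynomial.X ^ N ∣ (Polynomial.C lam - Pp) ^ N :=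
    X_pow_dvd_pow_of_coeff_zero (by rw [Polynomial.coeff_sub, Polynomial.coeff_C_zero, h3, sub_self]) N
  have hrw : Polynomial.C (lam ^ N) * Et - Polynomial.C τ * (Polynomial.C μ * Pt * M₁) =
      Pt * (Pp * Et - Polynomial.C μ * Wr) + (Polynomial.C lam - Pp) ^ N * Et := by
    rw [h2, map_pow]
    linear_combination (-Et) * hgeom
  rw [hrw]
  exact dvd_add (dvd_mul_of_dvd_right h1 _) (dvd_mul_of_dvd_left hdiv _)

end Generic

/-! ## §2 The DiDIL map `Φ : x_m ↦ z · x_m + c_m` into `R[x][z]` -/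

section Phi

variable {R : Type*} [CommRing R] {n : ℕ}

/-- `Φ` of an affine form `b₀ + ∑ b_m x_m` is `(b₀ + ∑ b_m c_m) + z · (∑ b_m x_m)`: a `z`-affine
form whose `z`-constant term is the VALUE `ℓ(c)` (DDS p0028 L751–754: "`Φ` homomorphism … it
suffices to ensure that `Φ(T_{i,0})|_{x=0} = T_{i,0}(α) ≠ 0`"). [cite: DuttaDwivediSaxena2022, §3.1
proof of Thm. 3.2 (full version p0028 L751–754)] -/
theorem aeval_phi_affine (c : Fin n → R) (b : Option (Fin n) → R) :
    aeval (fun m => Polynomial.X * Polynomial.C (X m) + Polynomial.C (C (c m)) :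
        Fin n → (MvPolynomial (Fin n) R)[X])
      (C (b none) + ∑ m, C (b (some m)) * X m) =
    Polynomial.C (C (b none + ∑ m, b (some m) * c m)) +
      Polynomial.X * Polynomial.C (∑ m, C (b (some m)) * X m) := by
  simp only [map_add, map_sum, map_mul, aeval_C, aeval_X, Polynomial.algebraMap_apply,
    MvPolynomial.algebraMap_eq, Finset.mul_sum]
  rw [add_assoc, ← Finset.sum_add_distrib]
  refine congrArg _ (Finset.sum_congr rfl fun m _ => by ring)

/-- `Φ` of `σ · ∏_j ℓ_j` is `σ · ∏_j (ℓ_j(c) + z · (∑_m b_{jm} x_m))`.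
[cite: DuttaDwivediSaxena2022, §3.1 proof of Thm. 3.2 (full version p0028 L751–754)] -/
theorem aeval_phi_C_mul_prod_affine {d : ℕ} (c : Fin n → R) (σ : R) (b : Fin d → Option (Fin n) → R) :
    aeval (fun m => Polynomial.X * Polynomial.C (X m) + Polynomial.C (C (c m)) :
        Fin n → (MvPolynomial (Fin n) R)[X])
      (C σ * ∏ j, (C (b j none) + ∑ m, C (b j (some m)) * X m)) =
    Polynomial.C (C σ) * ∏ j, (Polynomial.C (C (b j none + ∑ m, b j (some m) * c m)) +
      Polynomial.X * Polynomial.C (∑ m, C (b j (some m)) * X m)) := by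
  rw [map_mul, map_prod, aeval_C, Polynomial.algebraMap_apply, MvPolynomial.algebraMap_eq]
  exact congrArg _ (Finset.prod_congr rfl fun j _ => aeval_phi_affine c (b j))

/-- `Φ` commutes with a change of scalars `ψ : R → R'` (used with `ψ = (ε ↦ 0) : F[ε] → F`).
[folklore] -/
private theorem map_aeval_phi {R' : Type*} [CommRing R'] (ψ : R →+* R') (c : Fin n → R)
    (p : MvPolynomial (Fin n) R) :
    Polynomial.map (MvPolynomial.map ψ)
      (aeval (fun m => Polynomial.X * Polynomial.C (X m) + Polynomial.C (C (c m)) :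
        Fin n → (MvPolynomial (Fin n) R)[X]) p) =
    aeval (fun m => Polynomial.X * Polynomial.C (X m) + Polynomial.C (C (ψ (c m))) :
        Fin n → (MvPolynomial (Fin n) R')[X]) (MvPolynomial.map ψ p) := by
  have key : (Polynomial.mapRingHom (MvPolynomial.map ψ)).comp
      (aeval (fun m => Polynomial.X * Polynomial.C (X m) + Polynomial.C (C (c m)) :
        Fin n → (MvPolynomial (Fin n) R)[X])).toRingHom =
      (aeval (fun m => Polynomial.X * Polynomial.C (X m) + Polynomial.C (C (ψ (c m))) :
        Fin n → (MvPolynomial (Fin n) R')[X])).toRingHom.comp (MvPolynomial.map ψ) := by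
    refine MvPolynomial.ringHom_ext (fun r => ?_) (fun m => ?_)
    · simp only [RingHom.coe_comp, Function.comp_apply, AlgHom.toRingHom_eq_coe, AlgHom.coe_toRingHom,
        aeval_C, Polynomial.algebraMap_apply, MvPolynomial.algebraMap_eq, Polynomial.coe_mapRingHom,
        Polynomial.map_C, MvPolynomial.map_C]
    · simp only [RingHom.coe_comp, Function.comp_apply, AlgHom.toRingHom_eq_coe, AlgHom.coe_toRingHom,
        aeval_X, Polynomial.coe_mapRingHom, Polynomial.map_add, Polynomial.map_mul, Polynomial.map_X,
        Polynomial.map_C, MvPolynomial.map_X, MvPolynomial.map_C]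
  exact congrArg (fun h : MvPolynomial (Fin n) R →+* (MvPolynomial (Fin n) R')[X] => h p) key

/-- The `z`-constant term of `Φ(p)` is the constant `p(c)` (DDS p0028 L753–754:
`Φ(T_{i,0})|_{x=0} = T_{i,0}(α)`; here at `z = 0`). [cite: DuttaDwivediSaxena2022, §3.1 proof of
Thm. 3.2 (full version p0028 L751–754)] -/
theorem coeff_zero_aeval_phi (c : Fin n → R) (p : MvPolynomial (Fin n) R) :
    (aeval (fun m => Polynomial.X * Polynomial.C (X m) + Polynomial.C (C (c m)) :
        Fin n → (MvPolynomial (Fin n) R)[X]) p).coeff 0 = C (eval c p) := by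
  induction p using MvPolynomial.induction_on with
  | C a =>
    rw [aeval_C, Polynomial.algebraMap_apply, MvPolynomial.algebraMap_eq, Polynomial.coeff_C_zero,
      eval_C]
  | add p q hp hq => rw [map_add, Polynomial.coeff_add, hp, hq, map_add, map_add]
  | mul_X p m hp =>
    rw [map_mul, aeval_X, Polynomial.coeff_zero_eq_eval_zero, Polynomial.eval_mul,
      Polynomial.eval_add, Polynomial.eval_mul, Polynomial.eval_X, zero_mul, zero_add,
      Polynomial.eval_C, ← Polynomial.coeff_zero_eq_eval_zero, hp, map_mul, eval_X, map_mul]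

/-- **Bridge to the `MvPolynomial (Fin (n+1))` frame** of `UABPToolkit.lean` (`z = x_0`, the `x_i`
re-indexed by `Fin.succ`): `finSuccEquiv` carries `aeval (x_i ↦ x_0 x_{i+1} + c_i) p` to `Φ(p)`
(the same map `Φ : x_i ↦ z · x_i + α_i` of DDS p0028 L751–757, "think of the `z`-variable as
cost-free … apply `Φ⁻¹`", in the two coordinatisations of `F[x][z]` used in the tree; for `z`-free
data use the tree's `Hironaka2017.RationalApex.finSuccEquiv_rename_succ :
finSuccEquiv R n (rename Fin.succ q) = Polynomial.C q` and `finSuccEquiv_X_zero`).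
[cite: DuttaDwivediSaxena2022, §3.1 proof of Thm. 3.2 (full version p0028 L751–757)] -/
theorem finSuccEquiv_aeval_phi (c : Fin n → R) (p : MvPolynomial (Fin n) R) :
    finSuccEquiv R n (aeval (fun i : Fin n => (X 0 * X i.succ + C (c i) : MvPolynomial (Fin (n + 1)) R)) p) =
    aeval (fun m => Polynomial.X * Polynomial.C (X m) + Polynomial.C (C (c m)) :
        Fin n → (MvPolynomial (Fin n) R)[X]) p := by
  have hC : ∀ a : R, finSuccEquiv R n (C a) = Polynomial.C (C a) := fun a => by
    rw [finSuccEquiv_apply, eval₂Hom_C, RingHom.comp_apply]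
  induction p using MvPolynomial.induction_on with
  | C a => rw [aeval_C, aeval_C, MvPolynomial.algebraMap_eq, hC, Polynomial.algebraMap_apply,
      MvPolynomial.algebraMap_eq]
  | add p q hp hq => rw [map_add, map_add, hp, hq, map_add]
  | mul_X p m hp =>
    rw [map_mul, map_mul, hp, aeval_X, map_mul, aeval_X, map_add, map_mul, finSuccEquiv_X_zero,
      finSuccEquiv_X_succ, hC]

/-- Coefficients of `∑_{r<N} q_r z^r`. [folklore] -/
private theorem coeff_sum_C_mul_X_pow {S : Type*} [CommSemiring S] (N : ℕ) (q : ℕ → S) (r : ℕ) :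
    (∑ r' ∈ range N, Polynomial.C (q r') * Polynomial.X ^ r').coeff r = if r < N then q r else 0 := by
  rw [Polynomial.finsetSum_coeff]
  simp_rw [Polynomial.coeff_C_mul_X_pow]
  rw [Finset.sum_ite_eq]
  simp only [Finset.mem_range]

end Phi

/-! ## §3 The `k = 2` case of Thm. 3.2 on the `ε`-side: the `dlog` identity at `ε = 0` -/

section TopFaninTwo

variable {F : Type*} [Field F] {n : ℕ}

/-- The constant coefficient of an affine form. [folklore] -/
private theorem coeff_zero_affineForm (b : Option (Fin n) → F) :
    coeff 0 (C (b none) + ∑ m, C (b (some m)) * X m : MvPolynomial (Fin n) F) = b none := by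
  classical
  rw [coeff_add, coeff_C, if_pos rfl, coeff_sum, Finset.sum_eq_zero, add_zero]
  intro m _
  rw [coeff_C_mul, coeff_X, if_neg (Finsupp.single_ne_zero.mpr one_ne_zero), mul_zero]

/-- The coefficient of `x_m` of an affine form. [folklore] -/
private theorem coeff_single_affineForm (b : Option (Fin n) → F) (m : Fin n) :
    coeff (Finsupp.single m 1) (C (b none) + ∑ m, C (b (some m)) * X m : MvPolynomial (Fin n) F) =
      b (some m) := by
  classical
  rw [coeff_add, coeff_C, if_neg (Finsupp.single_ne_zero.mpr one_ne_zero).symm, zero_add,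
    coeff_sum, Finset.sum_eq_single m]
  · rw [coeff_C_mul, coeff_X, if_pos rfl, mul_one]
  · intro m' _ hm'
    rw [coeff_C_mul, coeff_X, if_neg, mul_zero]
    intro h
    exact hm' (Finsupp.single_left_injective one_ne_zero h)
  · intro h; exact absurd (Finset.mem_univ m) h

/-- An affine form with a non-zero coefficient is non-zero. [folklore] -/
private theorem affineForm_ne_zero {b : Option (Fin n) → F} (h : ∃ o, b o ≠ 0) :
    (C (b none) + ∑ m, C (b (some m)) * X m : MvPolynomial (Fin n) F) ≠ 0 := by
  obtain ⟨o, ho⟩ := h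
  intro h0
  cases o with
  | none => exact ho (by rw [← coeff_zero_affineForm b, h0, coeff_zero])
  | some m => exact ho (by rw [← coeff_single_affineForm b m, h0, coeff_zero])

/-- Over an infinite field a non-zero polynomial has a non-root — the DiDIL point `α`: DDS p0028
L753–754 "`α_i` are random elements in `F`. Essentially, it suffices to ensure that
`Φ(T_{i,0})|_{x=0} = T_{i,0}(α) ≠ 0`". [cite: DuttaDwivediSaxena2022, §3.1 proof of Thm. 3.2 (full
version p0028 L753–754)] -/
theorem exists_eval_ne_zero [Infinite F] {p : MvPolynomial (Fin n) F} (hp : p ≠ 0) :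
    ∃ α : Fin n → F, eval α p ≠ 0 := by
  by_contra h
  push Not at h
  exact hp (MvPolynomial.funext fun x => by rw [h x, map_zero])

/-- **DDS Thm. 3.2 for `k = 2`, the `ε`-side (DiDIL with one division and one derivative), after
[DuttaLysikov2025] §4.4.1.** Let `f ∈ F[x]` lie in the border of `Σ^{[2]}Π^{[d]}Σ` over `F(ε)`
and let `N ∈ ℕ`. Then either `f ∈ Σ^{[2]}Π^{[d]}Σ` over `F` already (degenerate limits), or there
are: a point `α ∈ F^n` with its DiDIL map `Φ : x_m ↦ z x_m + α_m` (into `F[x][z]`), two products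
`T_i = σ_i ∏_j ℓ_{ij}` of `d` affine forms with `T_i(α) ≠ 0` (the `ε = 0` parts of the two
bordered products, made `z`-units by `Φ`), a constant `c ∈ F^×` and polynomials
`q_r ∈ border Σ∧Σ(2d, r+1)` (`r < N`; the `ε → 0` limits of the `z^r`-coefficients of
`ε^{-a} · (dlog Φ(T̂_0) − dlog Φ(T̂_1))`, DDS Eqn. (3.3)), such that, coefficientwise below `z^N`,

  `c · (Φ(f)' · Φ(T_1) − Φ(f) · Φ(T_1)') ≡ Φ(T_0) Φ(T_1) · ∑_{r<N} q_r z^r   (mod z^N)`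

(`'` = `d/dz`). With `Φ(T_1)(0) = T_1(α) ∈ F^×` (`coeff_zero_aeval_phi`) this determines
`Φ(f)/Φ(T_1) mod z^N` from `f(α)` by one integration — the survey's
"`Φ(f)/t_2 = …` follows by integrating a `Σ∧Σ/ΠΣ` expression" — and is the input of the ABP
assembly (`DDS21TraceBackFinalStep.lean`, bricks B3/B5; bridge `finSuccEquiv_aeval_phi`).
[cite: DuttaLysikov2025, §4.4.1 "The `k = 2` case" (arXiv:2510.13049 p0023 L40 – p0024 L30)]
[cite: DuttaDwivediSaxena2022, §3.1 proof of Thm. 3.2, "Divide and derive" and Eqn. (3.3) (full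
version p0028 L745 – p0029 L773, p0031 L836 – p0032 L858)] -/
theorem border_spsClass_two_dlog_identity [CharZero F] {d : ℕ} {f : MvPolynomial (Fin n) F}
    (hf : f ∈ border (spsClass (RatFunc F) n 2 d)) (N : ℕ) :
    f ∈ spsClass F n 2 d ∨
    ∃ (α : Fin n → F) (Φ : MvPolynomial (Fin n) F →ₐ[F] (MvPolynomial (Fin n) F)[X])
      (σ : Fin 2 → F) (A : Fin 2 → Fin d → Option (Fin n) → F) (T : Fin 2 → MvPolynomial (Fin n) F)
      (c : F) (q : ℕ → MvPolynomial (Fin n) F),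
      Φ = aeval (fun m => Polynomial.X * Polynomial.C (X m) + Polynomial.C (C (α m))) ∧
      (∀ i, T i = C (σ i) * ∏ j, (C (A i j none) + ∑ m, C (A i j (some m)) * X m)) ∧
      (∀ i, eval α (T i) ≠ 0) ∧ c ≠ 0 ∧
      (∀ r < N, q r ∈ border (swsClass (RatFunc F) n (2 * d) (r + 1))) ∧
      ∀ r < N,
        (Polynomial.C (C c) * (Polynomial.derivative (Φ f) * Φ (T 1) -
          Φ f * Polynomial.derivative (Φ (T 1)))).coeff r =
        (Φ (T 0) * Φ (T 1) * ∑ r' ∈ range N, Polynomial.C (q r') * Polynomial.X ^ r').coeff r := by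
  classical
  rcases border_spsClass_two_normalForm hf with hsps | ⟨a, s, β, H, κ, ha, hs, hκ, hβ, hH, hsum⟩
  · exact Or.inl hsps
  refine Or.inr ?_
  set ι : F[X] →+* RatFunc F := algebraMap F[X] (RatFunc F) with hι
  set cc : F[X] →+* F := Polynomial.constantCoeff with hcc
  have hιX : ι (Polynomial.X ^ a) ≠ 0 :=
    (map_ne_zero_iff _ (IsFractionRing.injective F[X] (RatFunc F))).mpr
      (pow_ne_zero _ Polynomial.X_ne_zero)
  /- (1) reduced coefficients `Ā`, reduced forms `ℓ̄_{ij} ≠ 0`, and the DiDIL point `α` with every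
  `ℓ̄_{ij}(α) ≠ 0` (DDS p0028 L751–753). -/
  set Ab : Fin 2 → Fin d → Option (Fin n) → F := fun i j o => cc (β i j o) with hAb
  have hℓ : ∀ i j, (C (Ab i j none) + ∑ m, C (Ab i j (some m)) * X m : MvPolynomial (Fin n) F) ≠ 0 :=
    fun i j => affineForm_ne_zero (hβ i j)
  obtain ⟨α, hα⟩ := exists_eval_ne_zero
    (Finset.prod_ne_zero_iff.mpr fun (p : Fin 2 × Fin d) _ => hℓ p.1 p.2 :
      ∏ p : Fin 2 × Fin d, (C (Ab p.1 p.2 none) + ∑ m, C (Ab p.1 p.2 (some m)) * X m) ≠ 0)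
  rw [map_prod] at hα
  set a0 : Fin 2 → Fin d → F := fun i j => Ab i j none + ∑ m, Ab i j (some m) * α m with ha0
  have ha0' : ∀ i j, eval α (C (Ab i j none) + ∑ m, C (Ab i j (some m)) * X m) = a0 i j := by
    intro i j
    simp only [ha0, map_add, map_sum, map_mul, eval_C, eval_X]
  have ha0ne : ∀ i j, a0 i j ≠ 0 := fun i j => by
    rw [← ha0']
    exact (Finset.prod_ne_zero_iff.mp hα) (i, j) (Finset.mem_univ _)
  /- (2) `ε`-level: `A_{ij} := ℓ̂_{ij}(α) ∈ F[ε]` with `A_{ij}(0) = ℓ̄_{ij}(α) ≠ 0`,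
  `B_{ij} := ∑_m β_{ijm} x_m`, `W_i := Φ(T̂_i) = s_i ∏_j (A_{ij} + z B_{ij})`, and
  `W_0 + W_1 = ε^a Φ(H)` (from Part (A)). -/
  set Ae : Fin 2 → Fin d → F[X] := fun i j =>
    β i j none + ∑ m, β i j (some m) * Polynomial.C (α m) with hAe
  set Bx : Fin 2 → Fin d → MvPolynomial (Fin n) F[X] := fun i j =>
    ∑ m, C (β i j (some m)) * X m with hBx
  have hAe0 : ∀ i j, cc (Ae i j) = a0 i j := by
    intro i j
    simp only [hAe, ha0, hAb, hcc, map_add, map_sum, map_mul, Polynomial.constantCoeff_apply,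
      Polynomial.coeff_C_zero]
  set φA : Fin n → (MvPolynomial (Fin n) F[X])[X] := fun m =>
    Polynomial.X * Polynomial.C (X m) + Polynomial.C (C (Polynomial.C (α m))) with hφA
  obtain ⟨W, hW⟩ : ∃ W : Fin 2 → (MvPolynomial (Fin n) F[X])[X], ∀ i, W i =
      Polynomial.C (C (s i)) *
        ∏ j, (Polynomial.C (C (Ae i j)) + Polynomial.X * Polynomial.C (Bx i j)) :=
    ⟨_, fun _ => rfl⟩
  have hΦT : ∀ i, aeval φA (C (s i) * ∏ j, (C (β i j none) + ∑ m, C (β i j (some m)) * X m)) =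
      W i := by
    intro i
    rw [hW, hφA, aeval_phi_C_mul_prod_affine]
  have hN1 : W 0 + W 1 = Polynomial.C (C (Polynomial.X ^ a)) * aeval φA H := by
    have h := congrArg (aeval φA) hsum
    rwa [map_sum, Fin.sum_univ_two, hΦT 0, hΦT 1, map_mul, aeval_C, Polynomial.algebraMap_apply,
      MvPolynomial.algebraMap_eq] at h
  /- (3) §1 over `S := F[ε][x]`: the Wronskian is `ε^a · M₁` and `z^N ∣ λ^N Ẽ − ε^a M₂`. -/
  have h1 := wronskian_dlog_congr N (fun i => C (s i)) (fun i j => C (Ae i j)) Bx W hW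
  beta_reduce at h1
  set Et : (MvPolynomial (Fin n) F[X])[X] :=
    (∑ j, Polynomial.C ((∏ p ∈ univ.erase ((0 : Fin 2), j), C (Ae p.1 p.2)) ^ N * Bx 0 j) *
        (∑ k ∈ range N, Polynomial.C (C (Ae 0 j)) ^ k *
          (-(Polynomial.X * Polynomial.C (Bx 0 j))) ^ (N - 1 - k))) -
      ∑ j, Polynomial.C ((∏ p ∈ univ.erase ((1 : Fin 2), j), C (Ae p.1 p.2)) ^ N * Bx 1 j) *
        (∑ k ∈ range N, Polynomial.C (C (Ae 1 j)) ^ k *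
          (-(Polynomial.X * Polynomial.C (Bx 1 j))) ^ (N - 1 - k)) with hEt
  have hW0 : W 0 = Polynomial.C (C (Polynomial.X ^ a)) * aeval φA H - W 1 := by
    rw [← hN1]
    ring
  set M₁ : (MvPolynomial (Fin n) F[X])[X] :=
    Polynomial.derivative (aeval φA H) * W 1 - aeval φA H * Polynomial.derivative (W 1) with hM₁
  have h2 : Polynomial.derivative (W 0) * W 1 - W 0 * Polynomial.derivative (W 1) =
      Polynomial.C (C (Polynomial.X ^ a)) * M₁ := by
    rw [hW0, Polynomial.derivative_sub, Polynomial.derivative_C_mul, hM₁]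
    ring
  obtain ⟨lamA, hlamA⟩ : ∃ lamA : F[X], lamA = (s 0 * ∏ j, Ae 0 j) * (s 1 * ∏ j, Ae 1 j) :=
    ⟨_, rfl⟩
  have h3 : (W 0 * W 1).coeff 0 = C lamA := by
    rw [Polynomial.mul_coeff_zero, hW, hW, coeff_zero_C_mul_prod_affine,
      coeff_zero_C_mul_prod_affine, hlamA, map_mul, map_mul, map_mul, map_prod, map_prod]
  have h4 := X_pow_dvd_unit_mul_sub h1 h2 h3
  set M₂ : (MvPolynomial (Fin n) F[X])[X] :=
    Polynomial.C ((∏ p : Fin 2 × Fin d, C (Ae p.1 p.2)) ^ N) *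
      (∑ k ∈ range N, Polynomial.C (C lamA) ^ k * (Polynomial.C (C lamA) - W 0 * W 1) ^ (N - 1 - k)) *
      M₁ with hM₂
  have hcoef : ∀ r < N, C lamA ^ N * Et.coeff r = C (Polynomial.X ^ a) * M₂.coeff r := by
    intro r hr
    have h := coeff_eq_of_X_pow_dvd_sub h4 hr
    rwa [Polynomial.coeff_C_mul, Polynomial.coeff_C_mul] at h
  /- (4) the `z^r`-coefficient of `Ẽ` is a sum of `2d` powers `B_{ij}^{r+1}` (DDS Eqn. (3.3)), so
  `M₂`'s coefficients are, over `F(ε)`, in `Σ∧Σ(2d, r+1)`, and their `ε = 0` parts `q_r` are in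
  the border. -/
  have hEt_coeff : ∀ r < N, Et.coeff r =
      ∑ j, ((∏ p ∈ univ.erase ((0 : Fin 2), j), C (Ae p.1 p.2)) ^ N * Bx 0 j) *
          (C (Ae 0 j) ^ (N - 1 - r) * (-Bx 0 j) ^ r) -
        ∑ j, ((∏ p ∈ univ.erase ((1 : Fin 2), j), C (Ae p.1 p.2)) ^ N * Bx 1 j) *
          (C (Ae 1 j) ^ (N - 1 - r) * (-Bx 1 j) ^ r) := by
    intro r hr
    simp only [hEt, Polynomial.coeff_sub, Polynomial.finsetSum_coeff, Polynomial.coeff_C_mul,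
      coeff_geomInv _ _ hr]
  obtain ⟨bK, hbK0, hbKs⟩ : ∃ bK : Fin 2 → Fin d → Option (Fin n) → RatFunc F,
      (∀ i j, bK i j none = 0) ∧ ∀ i j m, bK i j (some m) = ι (β i j (some m)) :=
    ⟨fun i j o => o.elim 0 fun m => ι (β i j (some m)), fun _ _ => rfl, fun _ _ _ => rfl⟩
  have hsummand : ∀ (r : ℕ) (i : Fin 2) (j : Fin d), MvPolynomial.map ι
      (((∏ p ∈ univ.erase (i, j), C (Ae p.1 p.2)) ^ N * Bx i j) *
        (C (Ae i j) ^ (N - 1 - r) * (-Bx i j) ^ r)) ∈ swsClass (RatFunc F) n 1 (r + 1) := by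
    intro r i j
    have hshape : MvPolynomial.map ι
        (((∏ p ∈ univ.erase (i, j), C (Ae p.1 p.2)) ^ N * Bx i j) *
          (C (Ae i j) ^ (N - 1 - r) * (-Bx i j) ^ r)) =
        C (ι ((∏ p ∈ univ.erase (i, j), Ae p.1 p.2) ^ N * Ae i j ^ (N - 1 - r) * (-1) ^ r)) *
          (C (bK i j none) + ∑ m, C (bK i j (some m)) * X m) ^ (r + 1) := by
      rw [hbK0, map_zero, zero_add]
      simp_rw [hbKs]
      simp only [hBx, map_mul, map_pow, map_neg, map_one, map_prod, map_sum, map_C, map_X]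
      ring
    rw [hshape]
    exact C_mul_affinePow_mem_swsClass le_rfl le_rfl _ (bK i j)
  have hmemK : ∀ r < N,
      MvPolynomial.map ι (Et.coeff r) ∈ swsClass (RatFunc F) n (2 * d) (r + 1) := by
    intro r hr
    rw [hEt_coeff r hr, map_sub, map_sum, map_sum]
    have hS : ∀ i : Fin 2, ∑ j, MvPolynomial.map ι
        (((∏ p ∈ univ.erase (i, j), C (Ae p.1 p.2)) ^ N * Bx i j) *
          (C (Ae i j) ^ (N - 1 - r) * (-Bx i j) ^ r)) ∈ swsClass (RatFunc F) n (d * 1) (r + 1) := by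
      intro i
      have h := sum_univ_mem_swsClass _ fun j => hsummand r i j
      rwa [Fintype.card_fin] at h
    exact swsClass_mono (by omega) le_rfl (sub_mem_swsClass (hS 0) (hS 1))
  set red : MvPolynomial (Fin n) F[X] →+* MvPolynomial (Fin n) F := MvPolynomial.map cc with hred
  set q : ℕ → MvPolynomial (Fin n) F := fun r => red (M₂.coeff r) with hq
  have hqmem : ∀ r < N, q r ∈ border (swsClass (RatFunc F) n (2 * d) (r + 1)) := by
    intro r hr
    have h : C (ι (Polynomial.X ^ a)) * MvPolynomial.map ι (M₂.coeff r) =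
        C (ι (lamA ^ N)) * MvPolynomial.map ι (Et.coeff r) := by
      have h0 := congrArg (MvPolynomial.map ι) (hcoef r hr)
      rw [map_mul, map_mul, map_pow, map_C, map_C, ← map_pow, ← map_pow] at h0
      exact h0.symm
    have key : MvPolynomial.map ι (M₂.coeff r) =
        C ((ι (Polynomial.X ^ a))⁻¹ * ι (lamA ^ N)) * MvPolynomial.map ι (Et.coeff r) := by
      calc MvPolynomial.map ι (M₂.coeff r)
          = C (ι (Polynomial.X ^ a))⁻¹ * (C (ι (Polynomial.X ^ a)) *
              MvPolynomial.map ι (M₂.coeff r)) := by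
            rw [← mul_assoc, ← map_mul, inv_mul_cancel₀ hιX, map_one, one_mul]
        _ = C ((ι (Polynomial.X ^ a))⁻¹ * ι (lamA ^ N)) * MvPolynomial.map ι (Et.coeff r) := by
            rw [h, ← mul_assoc, ← map_mul]
    simp only [hq, hred, hcc]
    apply map_constantCoeff_mem_border
    rw [key]
    exact C_mul_mem_swsClass _ (hmemK r hr)
  /- (5) `ε = 0`: `W_i ↦ w_i := Φ(T_i)`, `Φ_ε(H) ↦ κ Φ(f)`, `M₁ ↦ κ (Φ(f)' w_1 − Φ(f) w_1')`,
  and `w_0 w_1` is a unit mod `z^N` (its `z`-constant term is the non-zero constant `λ₀`). -/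
  set φF : Fin n → (MvPolynomial (Fin n) F)[X] := fun m =>
    Polynomial.X * Polynomial.C (X m) + Polynomial.C (C (α m)) with hφF
  obtain ⟨T, hT⟩ : ∃ T : Fin 2 → MvPolynomial (Fin n) F, ∀ i, T i =
      C (cc (s i)) * ∏ j, (C (Ab i j none) + ∑ m, C (Ab i j (some m)) * X m) := ⟨_, fun _ => rfl⟩
  have hredBx : ∀ i j, red (Bx i j) = ∑ m, C (Ab i j (some m)) * X m := by
    intro i j
    simp only [hred, hBx, hAb, map_sum, map_mul, map_C, map_X]
  have hwexp : ∀ i, aeval φF (T i) = Polynomial.C (C (cc (s i))) *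
      ∏ j, (Polynomial.C (C (a0 i j)) + Polynomial.X * Polynomial.C (red (Bx i j))) := by
    intro i
    rw [hT, hφF, aeval_phi_C_mul_prod_affine]
    refine congrArg _ (Finset.prod_congr rfl fun j _ => ?_)
    rw [hredBx]
  have hredW : ∀ i, Polynomial.map red (W i) = aeval φF (T i) := by
    intro i
    rw [hW, hwexp, Polynomial.map_mul, Polynomial.map_prod, Polynomial.map_C]
    simp only [Polynomial.map_add, Polynomial.map_mul, Polynomial.map_C, Polynomial.map_X, hred,
      MvPolynomial.map_C, hAe0]
  have hredΦ : Polynomial.map red (aeval φA H) = Polynomial.C (C κ) * aeval φF f := by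
    rw [hφA, hred, map_aeval_phi, hH, map_mul, aeval_C, Polynomial.algebraMap_apply,
      MvPolynomial.algebraMap_eq, hφF]
    simp only [hcc, Polynomial.constantCoeff_apply, Polynomial.coeff_C_zero]
  set g : (MvPolynomial (Fin n) F)[X] := aeval φF f with hg
  set V : (MvPolynomial (Fin n) F)[X] :=
    Polynomial.derivative g * aeval φF (T 1) - g * Polynomial.derivative (aeval φF (T 1)) with hV
  have hredM₁ : Polynomial.map red M₁ = Polynomial.C (C κ) * V := by
    rw [hM₁, Polynomial.map_sub, Polynomial.map_mul, Polynomial.map_mul, ← Polynomial.derivative_map,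
      ← Polynomial.derivative_map, hredΦ, hredW, Polynomial.derivative_C_mul, hV]
    ring
  obtain ⟨Lam0, hLam0⟩ : ∃ Lam0 : F, Lam0 = ∏ p : Fin 2 × Fin d, a0 p.1 p.2 := ⟨_, rfl⟩
  obtain ⟨lam0, hlam0⟩ : ∃ lam0 : F, lam0 = (cc (s 0) * ∏ j, a0 0 j) * (cc (s 1) * ∏ j, a0 1 j) :=
    ⟨_, rfl⟩
  have hLam0ne : Lam0 ≠ 0 := hLam0 ▸ Finset.prod_ne_zero_iff.mpr fun p _ => ha0ne p.1 p.2
  have hs' : ∀ i, cc (s i) ≠ 0 := fun i => by rw [hcc, Polynomial.constantCoeff_apply]; exact hs i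
  have hlam0ne : lam0 ≠ 0 := hlam0 ▸
    mul_ne_zero (mul_ne_zero (hs' 0) (Finset.prod_ne_zero_iff.mpr fun j _ => ha0ne 0 j))
      (mul_ne_zero (hs' 1) (Finset.prod_ne_zero_iff.mpr fun j _ => ha0ne 1 j))
  have hredμ : red ((∏ p : Fin 2 × Fin d, C (Ae p.1 p.2)) ^ N) = C (Lam0 ^ N) := by
    rw [map_pow, map_prod, hLam0, map_pow, map_prod]
    simp only [hred, MvPolynomial.map_C, hAe0]
  have hredlam : red (C lamA) = C lam0 := by
    rw [hred, MvPolynomial.map_C, hlamA, hlam0]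
    simp only [map_mul, map_prod, hAe0]
  set D : (MvPolynomial (Fin n) F)[X] :=
    Polynomial.C (C lam0) - aeval φF (T 0) * aeval φF (T 1) with hD
  set Pt0 : (MvPolynomial (Fin n) F)[X] :=
    ∑ k ∈ range N, Polynomial.C (C lam0) ^ k * D ^ (N - 1 - k) with hPt0
  have hredPt : Polynomial.map red
      (∑ k ∈ range N, Polynomial.C (C lamA) ^ k * (Polynomial.C (C lamA) - W 0 * W 1) ^ (N - 1 - k)) =
      Pt0 := by
    rw [Polynomial.map_sum, hPt0]
    refine Finset.sum_congr rfl fun k _ => ?_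
    rw [Polynomial.map_mul, Polynomial.map_pow, Polynomial.map_pow, Polynomial.map_sub,
      Polynomial.map_mul, Polynomial.map_C, hredlam, hredW, hredW, hD]
  have hredM₂ : Polynomial.map red M₂ = Polynomial.C (C (Lam0 ^ N)) * Pt0 * (Polynomial.C (C κ) * V) := by
    rw [hM₂, Polynomial.map_mul, Polynomial.map_mul, Polynomial.map_C, hredμ, hredPt, hredM₁]
  have hw0 : (aeval φF (T 0) * aeval φF (T 1)).coeff 0 = C lam0 := by
    rw [Polynomial.mul_coeff_zero, hwexp, hwexp, coeff_zero_C_mul_prod_affine,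
      coeff_zero_C_mul_prod_affine, hlam0, map_mul, map_mul, map_mul, map_prod, map_prod]
  have hgeomF : Pt0 * (aeval φF (T 0) * aeval φF (T 1)) = Polynomial.C (C lam0) ^ N - D ^ N := by
    have h := geom_sum₂_mul (Polynomial.C (C lam0)) D N
    rw [hD, sub_sub_cancel] at h
    rw [hPt0, hD]
    exact h
  have hdivF : Polynomial.X ^ N ∣ D ^ N :=
    X_pow_dvd_pow_of_coeff_zero
      (by rw [hD, Polynomial.coeff_sub, Polynomial.coeff_C_zero, hw0, sub_self]) N
  /- (6) `Q := ∑_{r<N} q_r z^r ≡ M₂|_{ε=0}` and the final congruence. -/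
  set Q : (MvPolynomial (Fin n) F)[X] := ∑ r' ∈ range N, Polynomial.C (q r') * Polynomial.X ^ r'
    with hQ
  have hQM : Polynomial.X ^ N ∣ Polynomial.map red M₂ - Q :=
    X_pow_dvd_sub_of_coeff_eq fun r hr => by
      rw [Polynomial.coeff_map, hQ, coeff_sum_C_mul_X_pow, if_pos hr]
  obtain ⟨c, hc⟩ : ∃ c : F, c = Lam0 ^ N * κ * lam0 ^ N := ⟨_, rfl⟩
  have hc0 : c ≠ 0 :=
    hc ▸ mul_ne_zero (mul_ne_zero (pow_ne_zero _ hLam0ne) hκ) (pow_ne_zero _ hlam0ne)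
  have e1 : aeval φF (T 0) * aeval φF (T 1) * Polynomial.map red M₂ =
      Polynomial.C (C (Lam0 ^ N * κ)) * (Polynomial.C (C lam0) ^ N - D ^ N) * V := by
    rw [hredM₂, map_mul, map_mul]
    rw [← hgeomF]
    ring
  have hrw : Polynomial.C (C c) * V - aeval φF (T 0) * aeval φF (T 1) * Q =
      Polynomial.C (C (Lam0 ^ N * κ)) * D ^ N * V +
        aeval φF (T 0) * aeval φF (T 1) * (Polynomial.map red M₂ - Q) := by
    rw [mul_sub (aeval φF (T 0) * aeval φF (T 1)), e1, hc]
    simp only [map_mul, map_pow]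
    ring
  have hfin : Polynomial.X ^ N ∣ Polynomial.C (C c) * V - aeval φF (T 0) * aeval φF (T 1) * Q := by
    rw [hrw]
    exact dvd_add (dvd_mul_of_dvd_left (dvd_mul_of_dvd_right hdivF _) _)
      (dvd_mul_of_dvd_right hQM _)
  /- (7) assemble. -/
  refine ⟨α, aeval φF, fun i => cc (s i), Ab, T, c, q, rfl, hT, fun i => ?_, hc0, hqmem,
    fun r hr => ?_⟩
  · rw [hT, map_mul, eval_C, map_prod]
    simp_rw [ha0']
    exact mul_ne_zero (hs' i) (Finset.prod_ne_zero_iff.mpr fun j _ => ha0ne i j)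
  · exact coeff_eq_of_X_pow_dvd_sub hfin hr

end TopFaninTwo

/-! ## §4 Solving the `dlog` identity: `Φ(f) mod z^{N+1}` from `f(α)` by one integration

(v2 append.) DDS Claim 3.7 / "trace back", for `k = 2`: from the congruence of §3 and the value
`Φ(f)|_{z=0} = f(α)`, the quotient `Φ(f)/Φ(T_1)` is recovered modulo `z^{N+1}` by "definite
integration" (full version p0034 L913 – p0035 L923: "`f/t − f/t|_{z=0} ≡ ∑_{i≥1} (C_i/i) z^i`"),
the inverse of the `z`-unit `Φ(T_1)` being a truncated geometric series. Denominator-free, over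
any domain `S` of characteristic `0` (`S = F[x]` in §5). -/

section Solve

variable {S : Type*} [CommRing S] [IsDomain S] [CharZero S]

/-- **Uniqueness of "integration"** (Wronskian form): if `w(0) ≠ 0`, `E(0) = 0` and
`z^N ∣ w E' − w' E`, then `z^{N+1} ∣ E` — i.e. `(E/w)' ≡ 0 (mod z^N)` and `(E/w)(0) = 0` force
`E/w ≡ 0 (mod z^{N+1})`; this is the step "`f/t = f/t|_{z=0} + ∫ …`" of DDS Claim 3.7 without
denominators. [cite: DuttaDwivediSaxena2022, §3.1 proof of Thm. 3.2, Claim 3.7 (full version p0034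
L913 – p0035 L923)] -/
theorem X_pow_succ_dvd_of_wronskian {w E : S[X]} {N : ℕ} (hw : w.coeff 0 ≠ 0) (hE : E.coeff 0 = 0)
    (h : Polynomial.X ^ N ∣ w * Polynomial.derivative E - Polynomial.derivative w * E) :
    Polynomial.X ^ (N + 1) ∣ E := by
  suffices key : ∀ m, m ≤ N → Polynomial.X ^ (m + 1) ∣ E from key N le_rfl
  intro m
  induction m with
  | zero =>
    intro _
    rw [zero_add, pow_one]
    exact Polynomial.X_dvd_iff.mpr hE
  | succ m ih =>
    intro hm
    obtain ⟨G, hG⟩ := ih (Nat.le_of_succ_le hm)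
    have hE' : Polynomial.derivative E =
        Polynomial.C ((m + 1 : ℕ) : S) * Polynomial.X ^ m * G +
          Polynomial.X ^ (m + 1) * Polynomial.derivative G := by
      rw [hG, Polynomial.derivative_mul, Polynomial.derivative_X_pow, Nat.add_sub_cancel]
    have hfac : w * Polynomial.derivative E - Polynomial.derivative w * E =
        Polynomial.X ^ m * (Polynomial.C ((m + 1 : ℕ) : S) * w * G +
          Polynomial.X * (w * Polynomial.derivative G - Polynomial.derivative w * G)) := by
      rw [hE', hG]; ring
    rw [hfac] at h
    have hX : Polynomial.X ∣ Polynomial.C ((m + 1 : ℕ) : S) * w * G +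
        Polynomial.X * (w * Polynomial.derivative G - Polynomial.derivative w * G) := by
      have h' : Polynomial.X ^ m * Polynomial.X ∣ Polynomial.X ^ m *
          (Polynomial.C ((m + 1 : ℕ) : S) * w * G +
            Polynomial.X * (w * Polynomial.derivative G - Polynomial.derivative w * G)) := by
        rw [← pow_succ]
        exact (pow_dvd_pow Polynomial.X hm).trans h
      exact (mul_dvd_mul_iff_left (pow_ne_zero m Polynomial.X_ne_zero)).mp h'
    have hG0 : G.coeff 0 = 0 := by
      have h0 := Polynomial.X_dvd_iff.mp hX
      rw [Polynomial.coeff_add, Polynomial.coeff_X_mul_zero, add_zero, mul_assoc,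
        Polynomial.coeff_C_mul, Polynomial.mul_coeff_zero] at h0
      rcases mul_eq_zero.mp h0 with h1 | h1
      · exact absurd h1 (Nat.cast_ne_zero.mpr (Nat.succ_ne_zero m))
      · rcases mul_eq_zero.mp h1 with h2 | h2
        · exact absurd h2 hw
        · exact h2
    obtain ⟨G', hG'⟩ := Polynomial.X_dvd_iff.mpr hG0
    refine ⟨G', ?_⟩
    rw [hG, hG', pow_succ]
    ring

/-- **Solving the `k = 2` DiDIL congruence** (DDS Claim 3.7 "trace back", `k = 2`): if
`w₁(0) = λ ≠ 0`, `z^N ∣ c (g' w₁ − g w₁') − w₀ w₁ Q` (§3), and `V` is any "integral mod `z^N`" of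
`w₀ Q U` with `V(0) = 0`, where `U := ∑_{k<N} λ^k (λ − w₁)^{N−1−k}` is the truncated inverse of
`w₁` (`U w₁ ≡ λ^N`), then `z^{N+1} ∣ λ^N c · g − w₁ · (c λ^{N−1} g(0) + V)`: the numerator
`w₁ (c λ^{N−1} g(0) + V)` and the constant denominator `λ^N c` compute `g` modulo `z^{N+1}`.
[cite: DuttaDwivediSaxena2022, §3.1 proof of Thm. 3.2, Claim 3.7 (full version p0034 L905 – p0035
L925)] -/
theorem dlog_identity_solve {N : ℕ} (hN : 1 ≤ N) {g w₀ w₁ Q V : S[X]} {c lam : S} (hlam : lam ≠ 0)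
    (hw₁ : w₁.coeff 0 = lam)
    (hI : Polynomial.X ^ N ∣ Polynomial.C c *
      (Polynomial.derivative g * w₁ - g * Polynomial.derivative w₁) - w₀ * w₁ * Q)
    (hV : Polynomial.X ^ N ∣ Polynomial.derivative V -
      w₀ * Q * (∑ k ∈ range N, Polynomial.C lam ^ k * (Polynomial.C lam - w₁) ^ (N - 1 - k)))
    (hV0 : V.coeff 0 = 0) :
    Polynomial.X ^ (N + 1) ∣ Polynomial.C (lam ^ N * c) * g -
      w₁ * (Polynomial.C (c * lam ^ (N - 1) * g.coeff 0) + V) := by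
  set U := ∑ k ∈ range N, Polynomial.C lam ^ k * (Polynomial.C lam - w₁) ^ (N - 1 - k) with hU
  have hUw : Polynomial.X ^ N ∣ U * w₁ - Polynomial.C lam ^ N := by
    have hgeom : U * w₁ = Polynomial.C lam ^ N - (Polynomial.C lam - w₁) ^ N := by
      have h := geom_sum₂_mul (Polynomial.C lam) (Polynomial.C lam - w₁) N
      rwa [sub_sub_cancel] at h
    rw [hgeom, sub_sub_cancel_left, dvd_neg]
    exact X_pow_dvd_pow_of_coeff_zero
      (by rw [Polynomial.coeff_sub, Polynomial.coeff_C_zero, hw₁, sub_self]) N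
  set E := Polynomial.C (lam ^ N * c) * g -
    w₁ * (Polynomial.C (c * lam ^ (N - 1) * g.coeff 0) + V) with hEdef
  have hE0 : E.coeff 0 = 0 := by
    rw [hEdef, Polynomial.coeff_sub, Polynomial.coeff_C_mul, Polynomial.mul_coeff_zero,
      Polynomial.coeff_add, Polynomial.coeff_C_zero, hw₁, hV0, add_zero]
    obtain ⟨N', rfl⟩ := Nat.exists_eq_add_of_le' hN
    rw [Nat.add_sub_cancel]
    ring
  have hwr : w₁ * Polynomial.derivative E - Polynomial.derivative w₁ * E =
      Polynomial.C lam ^ N * (Polynomial.C c *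
          (Polynomial.derivative g * w₁ - g * Polynomial.derivative w₁) - w₀ * w₁ * Q) -
        w₁ ^ 2 * (Polynomial.derivative V - w₀ * Q * U) -
        w₀ * w₁ * Q * (U * w₁ - Polynomial.C lam ^ N) := by
    rw [hEdef, Polynomial.derivative_sub, Polynomial.derivative_C_mul, Polynomial.derivative_mul,
      Polynomial.derivative_add, Polynomial.derivative_C, zero_add, map_mul, map_pow]
    ring
  refine X_pow_succ_dvd_of_wronskian (by rw [hw₁]; exact hlam) hE0 ?_
  rw [hwr]
  exact dvd_sub (dvd_sub (dvd_mul_of_dvd_right hI _) (dvd_mul_of_dvd_right hV _))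
    (dvd_mul_of_dvd_right hUw _)

end Solve

/-! ## §5 In the frame of `UABPToolkit.lean`: `MvPolynomial (Fin (n+1)) F`, `z = x_0`,
"mod `z^D`" = `truncDegreeOf 0 D`, integration = `integrateDegreeOf 0` -/

section Frame

open Literature.RingTheory.MvPolynomial Literature.AlgebraicGeometry.Hironaka2017

variable {R : Type*} [CommRing R] {n : ℕ}

/-- `finSuccEquiv` turns `∂/∂x_0` into `d/dz` (the tree has this as
`Literature.Combinatorics.StablePolynomials.finSuccEquiv_pderiv_zero` in `GurvitsCapacityBound.lean`,
which starts with `import Mathlib`, and in `RationalPointsDecomposition.lean` behind Noether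
normalisation; restated privately in ten lines rather than importing either closure). [folklore] -/
private theorem derivative_finSuccEquiv_eq (p : MvPolynomial (Fin (n + 1)) R) :
    Polynomial.derivative (finSuccEquiv R n p) = finSuccEquiv R n (pderiv 0 p) := by
  induction p using MvPolynomial.induction_on with
  | C a =>
    rw [pderiv_C, map_zero, RationalApex.finSuccEquiv_C', Polynomial.derivative_C]
  | add p q hp hq => rw [map_add, map_add, map_add, map_add, hp, hq]
  | mul_X p i hp =>
    have hX : Polynomial.derivative (finSuccEquiv R n (X i)) = finSuccEquiv R n (pderiv 0 (X i)) := by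
      refine Fin.cases ?_ (fun j => ?_) i
      · rw [pderiv_X_self, map_one, finSuccEquiv_X_zero, Polynomial.derivative_X]
      · rw [pderiv_X_of_ne (Fin.succ_ne_zero j), map_zero, finSuccEquiv_X_succ,
          Polynomial.derivative_C]
    rw [Derivation.leibniz, smul_eq_mul, smul_eq_mul, map_add, map_mul (finSuccEquiv R n),
      map_mul (finSuccEquiv R n), map_mul (finSuccEquiv R n), Polynomial.derivative_mul, hp, hX]
    ring

/-- **"mod `z^N`" in the two frames**: `truncDegreeOf 0 N p = truncDegreeOf 0 N q` iff the
`z^r`-coefficients (`r < N`) of `finSuccEquiv p` and `finSuccEquiv q` agree (DDS: "`≡ mod z^d`",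
`R_0 = F[z]/⟨z^d⟩`). [cite: DuttaDwivediSaxena2022, §3.1 proof of Thm. 3.2 (full version p0028
L755–756, p0029 L779–782)] -/
theorem truncDegreeOf_zero_eq_iff (N : ℕ) (p q : MvPolynomial (Fin (n + 1)) R) :
    truncDegreeOf 0 N p = truncDegreeOf 0 N q ↔
      ∀ r < N, (finSuccEquiv R n p).coeff r = (finSuccEquiv R n q).coeff r := by
  classical
  rw [truncDegreeOf_eq_iff]
  constructor
  · intro h r hr
    ext m
    rw [finSuccEquiv_coeff_coeff, finSuccEquiv_coeff_coeff]
    exact h _ (by rwa [Finsupp.cons_zero])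
  · intro h d hd
    have h1 := congrArg (coeff (Finsupp.tail d)) (h (d 0) hd)
    rwa [finSuccEquiv_coeff_coeff, finSuccEquiv_coeff_coeff, Finsupp.cons_tail] at h1

/-- `z^N ∣ finSuccEquiv (truncDegreeOf 0 N p) − finSuccEquiv p`. [folklore] -/
private theorem X_pow_dvd_finSuccEquiv_truncDegreeOf_sub (N : ℕ) (p : MvPolynomial (Fin (n + 1)) R) :
    Polynomial.X ^ N ∣ finSuccEquiv R n (truncDegreeOf 0 N p) - finSuccEquiv R n p := by
  classical
  refine X_pow_dvd_sub_of_coeff_eq ((truncDegreeOf_zero_eq_iff N _ _).mp ?_)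
  rw [truncDegreeOf_truncDegreeOf, min_self]

variable {F : Type*} [Field F]

/-- The `z`-constant term of `finSuccEquiv (integrateDegreeOf 0 N p)` vanishes. [folklore] -/
private theorem coeff_zero_finSuccEquiv_integrateDegreeOf (N : ℕ) (p : MvPolynomial (Fin (n + 1)) F) :
    (finSuccEquiv F n (integrateDegreeOf 0 N p)).coeff 0 = 0 := by
  classical
  ext m
  rw [finSuccEquiv_coeff_coeff, coeff_zero]
  exact coeff_integrateDegreeOf_of_eq_zero 0 N p (Finsupp.cons_zero _ _)

/-- **DDS Thm. 3.2 for `k = 2`: the `ε`-free output of DiDIL + trace-back, in the frame of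
`UABPToolkit.lean`.** For `f` in the border of `Σ^{[2]}Π^{[d]}Σ` and `N ≥ 1`, either `f` is in the
class over `F`, or there are `α`, two products of affine forms `T_0, T_1` with `T_i(α) ≠ 0`,
`c ∈ F^×` and `q_r ∈ border Σ∧Σ(2d, r+1)` (`r < N`) with, for `Φ : x_i ↦ x_0 x_{i+1} + α_i`
(`z = x_0`) and `λ := T_1(α)`:

  `λ^N c · Φ(f) ≡ Φ(T_1) · ( c λ^{N−1} f(α) + ∫_N [ Φ(T_0) · (∑_{r<N} z^r q_r) · U ] )  (mod z^{N+1})`,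
  `U := ∑_{k<N} λ^k (λ − Φ(T_1))^{N−1−k}`

(`∫_N = integrateDegreeOf 0 N`, "mod" = equality of `truncDegreeOf 0 (N+1)`). This is exactly the
hypothesis shape of `DDS21TraceBackFinalStep.uabpComputes_of_phi_truncDegreeOf_eq` (`den := λ^N c`,
`Num :=` the right-hand side), whose ABP budgets are the consumers' (B3/B5).
[cite: DuttaLysikov2025, §4.4.1 "The `k = 2` case" (arXiv:2510.13049 p0023 L40 – p0024 L30)]
[cite: DuttaDwivediSaxena2022, §3.1 proof of Thm. 3.2, Claims 3.4–3.7 (full version p0028 L745 –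
p0035 L925)] -/
theorem border_spsClass_two_traceback [CharZero F] {d : ℕ} {f : MvPolynomial (Fin n) F}
    (hf : f ∈ border (spsClass (RatFunc F) n 2 d)) {N : ℕ} (hN : 1 ≤ N) :
    f ∈ spsClass F n 2 d ∨
    ∃ (α : Fin n → F) (σ : Fin 2 → F) (A : Fin 2 → Fin d → Option (Fin n) → F)
      (T : Fin 2 → MvPolynomial (Fin n) F) (c : F) (q : ℕ → MvPolynomial (Fin n) F),
      (∀ i, T i = C (σ i) * ∏ j, (C (A i j none) + ∑ m, C (A i j (some m)) * X m)) ∧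
      (∀ i, eval α (T i) ≠ 0) ∧ c ≠ 0 ∧
      (∀ r < N, q r ∈ border (swsClass (RatFunc F) n (2 * d) (r + 1))) ∧
      truncDegreeOf 0 (N + 1)
          (C (eval α (T 1) ^ N * c) *
            aeval (fun i : Fin n => (X 0 * X i.succ + C (α i) : MvPolynomial (Fin (n + 1)) F)) f) =
        truncDegreeOf 0 (N + 1)
          (aeval (fun i : Fin n => (X 0 * X i.succ + C (α i) : MvPolynomial (Fin (n + 1)) F)) (T 1) *
            (C (c * eval α (T 1) ^ (N - 1) * eval α f) +
              integrateDegreeOf 0 N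
                (aeval (fun i : Fin n => (X 0 * X i.succ + C (α i) : MvPolynomial (Fin (n + 1)) F))
                    (T 0) *
                  (∑ r ∈ range N, X 0 ^ r * rename Fin.succ (q r)) *
                  ∑ k ∈ range N, C (eval α (T 1)) ^ k *
                    (C (eval α (T 1)) -
                      aeval (fun i : Fin n =>
                        (X 0 * X i.succ + C (α i) : MvPolynomial (Fin (n + 1)) F)) (T 1)) ^
                      (N - 1 - k)))) := by
  classical
  rcases border_spsClass_two_dlog_identity hf N with hsps | ⟨α, Φ, σ, A, T, c, q, hΦ, hT, hT0, hc, hq, hid⟩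
  · exact Or.inl hsps
  refine Or.inr ⟨α, σ, A, T, c, q, hT, hT0, hc, hq, ?_⟩
  subst hΦ
  -- names in the two frames
  set ψ : Fin n → MvPolynomial (Fin (n + 1)) F := fun i => X 0 * X i.succ + C (α i) with hψ
  set φ : Fin n → (MvPolynomial (Fin n) F)[X] := fun m =>
    Polynomial.X * Polynomial.C (X m) + Polynomial.C (C (α m)) with hφ
  have hbr : ∀ p : MvPolynomial (Fin n) F, finSuccEquiv F n (aeval ψ p) = aeval φ p :=
    fun p => finSuccEquiv_aeval_phi α p
  generalize hlam : eval α (T 1) = lam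
  set g : (MvPolynomial (Fin n) F)[X] := aeval φ f with hg
  set w : Fin 2 → (MvPolynomial (Fin n) F)[X] := fun i => aeval φ (T i) with hw
  set Q : (MvPolynomial (Fin n) F)[X] := ∑ r ∈ range N, Polynomial.C (q r) * Polynomial.X ^ r with hQ
  set U : (MvPolynomial (Fin n) F)[X] :=
    ∑ k ∈ range N, Polynomial.C (C lam) ^ k * (Polynomial.C (C lam) - w 1) ^ (N - 1 - k) with hU
  set P18 : MvPolynomial (Fin (n + 1)) F :=
    aeval ψ (T 0) * (∑ r ∈ range N, X 0 ^ r * rename Fin.succ (q r)) *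
      ∑ k ∈ range N, C lam ^ k * (C lam - aeval ψ (T 1)) ^ (N - 1 - k) with hP18
  set V18 : MvPolynomial (Fin (n + 1)) F := integrateDegreeOf 0 N P18 with hV18
  -- transport of the data
  have hQ18 : finSuccEquiv F n (∑ r ∈ range N, X 0 ^ r * rename Fin.succ (q r)) = Q := by
    rw [map_sum, hQ]
    refine Finset.sum_congr rfl fun r _ => ?_
    rw [map_mul (finSuccEquiv F n), map_pow (finSuccEquiv F n), finSuccEquiv_X_zero,
      RationalApex.finSuccEquiv_rename_succ, mul_comm]
  have hU18 : finSuccEquiv F n (∑ k ∈ range N, C lam ^ k * (C lam - aeval ψ (T 1)) ^ (N - 1 - k)) =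
      U := by
    rw [map_sum, hU]
    refine Finset.sum_congr rfl fun k _ => ?_
    rw [map_mul (finSuccEquiv F n), map_pow (finSuccEquiv F n), map_pow (finSuccEquiv F n),
      map_sub (finSuccEquiv F n), RationalApex.finSuccEquiv_C', hbr]
  have hP : finSuccEquiv F n P18 = w 0 * Q * U := by
    rw [hP18, map_mul (finSuccEquiv F n), map_mul (finSuccEquiv F n), hbr, hQ18, hU18]
  -- hypotheses of §4
  have hw₁ : (w 1).coeff 0 = C lam := by
    rw [← hlam]
    exact coeff_zero_aeval_phi α (T 1)
  have hlam0 : (C lam : MvPolynomial (Fin n) F) ≠ 0 := by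
    rw [Ne, C_eq_zero, ← hlam]
    exact hT0 1
  have hI : Polynomial.X ^ N ∣ Polynomial.C (C c) *
      (Polynomial.derivative g * w 1 - g * Polynomial.derivative (w 1)) - w 0 * w 1 * Q :=
    X_pow_dvd_sub_of_coeff_eq hid
  have hV : Polynomial.X ^ N ∣ Polynomial.derivative (finSuccEquiv F n V18) - w 0 * Q * U := by
    rw [derivative_finSuccEquiv_eq, hV18, pderiv_integrateDegreeOf, ← hP]
    exact X_pow_dvd_finSuccEquiv_truncDegreeOf_sub N P18
  have hV0 : (finSuccEquiv F n V18).coeff 0 = 0 := coeff_zero_finSuccEquiv_integrateDegreeOf N P18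
  have hsol := dlog_identity_solve hN hlam0 hw₁ hI hV hV0
  -- back to the `MvPolynomial (Fin (n+1))` frame
  rw [truncDegreeOf_zero_eq_iff]
  intro r hr
  refine coeff_eq_of_X_pow_dvd_sub ?_ hr
  rw [hg, coeff_zero_aeval_phi α f, ← hg, ← map_pow, ← map_mul, ← map_pow, ← map_mul, ← map_mul]
    at hsol
  rw [map_mul (finSuccEquiv F n), map_mul (finSuccEquiv F n), map_add (finSuccEquiv F n),
    RationalApex.finSuccEquiv_C', RationalApex.finSuccEquiv_C', hbr, hbr]
  exact hsol

/-- **(★) in the frame of `UABPToolkit.lean`, Wronskian form** (v3 append) — exactly the hypothesis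
`hP` of the ABP-side `k = 2` trace-back (`AC/DDS21TopFaninTwoTraceBack.lean`,
`uabpComputes_of_wronskian_congr`, with `t₂ := T 1` and
`R := C c⁻¹ · Φ(T 0) · Φ(T 1) · ∑_{r<N} x_0^r · q_r`): for `Φ : x_i ↦ x_0 x_{i+1} + α_i`,
`∂_0 Φ(f) · Φ(T_1) − Φ(f) · ∂_0 Φ(T_1) ≡ c⁻¹ · Φ(T_0) Φ(T_1) · ∑_{r<N} x_0^r q_r  (mod x_0^N)`.
[cite: DuttaLysikov2025, §4.4.1 "The `k = 2` case" (arXiv:2510.13049 p0023 L40 – p0024 L30)]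
[cite: DuttaDwivediSaxena2022, §3.1 proof of Thm. 3.2, "Divide and derive" and Eqn. (3.3) (full
version p0028 L745 – p0029 L773, p0031 L836 – p0032 L858)] -/
theorem border_spsClass_two_wronskian_congr [CharZero F] {d : ℕ} {f : MvPolynomial (Fin n) F}
    (hf : f ∈ border (spsClass (RatFunc F) n 2 d)) (N : ℕ) :
    f ∈ spsClass F n 2 d ∨
    ∃ (α : Fin n → F) (σ : Fin 2 → F) (A : Fin 2 → Fin d → Option (Fin n) → F)
      (T : Fin 2 → MvPolynomial (Fin n) F) (c : F) (q : ℕ → MvPolynomial (Fin n) F),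
      (∀ i, T i = C (σ i) * ∏ j, (C (A i j none) + ∑ m, C (A i j (some m)) * X m)) ∧
      (∀ i, eval α (T i) ≠ 0) ∧ c ≠ 0 ∧
      (∀ r < N, q r ∈ border (swsClass (RatFunc F) n (2 * d) (r + 1))) ∧
      truncDegreeOf 0 N
          (pderiv 0 (aeval (fun i : Fin n => (X 0 * X i.succ + C (α i) : MvPolynomial (Fin (n + 1)) F)) f) *
              aeval (fun i : Fin n => (X 0 * X i.succ + C (α i) : MvPolynomial (Fin (n + 1)) F)) (T 1) -
            aeval (fun i : Fin n => (X 0 * X i.succ + C (α i) : MvPolynomial (Fin (n + 1)) F)) f *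
              pderiv 0 (aeval (fun i : Fin n =>
                (X 0 * X i.succ + C (α i) : MvPolynomial (Fin (n + 1)) F)) (T 1))) =
        truncDegreeOf 0 N
          (C c⁻¹ * (aeval (fun i : Fin n => (X 0 * X i.succ + C (α i) : MvPolynomial (Fin (n + 1)) F))
              (T 0) *
            aeval (fun i : Fin n => (X 0 * X i.succ + C (α i) : MvPolynomial (Fin (n + 1)) F)) (T 1) *
            ∑ r ∈ range N, X 0 ^ r * rename Fin.succ (q r))) := by
  classical
  rcases border_spsClass_two_dlog_identity hf N with hsps | ⟨α, Φ, σ, A, T, c, q, hΦ, hT, hT0, hc, hq, hid⟩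
  · exact Or.inl hsps
  refine Or.inr ⟨α, σ, A, T, c, q, hT, hT0, hc, hq, ?_⟩
  subst hΦ
  set ψ : Fin n → MvPolynomial (Fin (n + 1)) F := fun i => X 0 * X i.succ + C (α i) with hψ
  set φ : Fin n → (MvPolynomial (Fin n) F)[X] := fun m =>
    Polynomial.X * Polynomial.C (X m) + Polynomial.C (C (α m)) with hφ
  have hbr : ∀ p : MvPolynomial (Fin n) F, finSuccEquiv F n (aeval ψ p) = aeval φ p :=
    fun p => finSuccEquiv_aeval_phi α p
  have hQ18 : finSuccEquiv F n (∑ r ∈ range N, X 0 ^ r * rename Fin.succ (q r)) =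
      ∑ r' ∈ range N, Polynomial.C (q r') * Polynomial.X ^ r' := by
    rw [map_sum]
    refine Finset.sum_congr rfl fun r _ => ?_
    rw [map_mul (finSuccEquiv F n), map_pow (finSuccEquiv F n), finSuccEquiv_X_zero,
      RationalApex.finSuccEquiv_rename_succ, mul_comm]
  have hcC : (C c⁻¹ : MvPolynomial (Fin n) F) * C c = 1 := by
    rw [← map_mul, inv_mul_cancel₀ hc, map_one]
  rw [truncDegreeOf_zero_eq_iff]
  intro r hr
  rw [map_sub (finSuccEquiv F n), map_mul (finSuccEquiv F n), map_mul (finSuccEquiv F n),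
    ← derivative_finSuccEquiv_eq, ← derivative_finSuccEquiv_eq, map_mul (finSuccEquiv F n),
    map_mul (finSuccEquiv F n), map_mul (finSuccEquiv F n), RationalApex.finSuccEquiv_C', hbr, hbr,
    hbr, hQ18, Polynomial.coeff_C_mul, ← hid r hr, Polynomial.coeff_C_mul, ← mul_assoc, hcC, one_mul]

end Frame

end DDS2021

end Literature.Computability.AlgebraicComplexity
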